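import Mathlib
import Literature.NumberTheory.Transcendental.KZRulesAssociator
import Literature.NumberTheory.Transcendental.KZRelationsLE
import Literature.NumberTheory.Transcendental.KZLogCalculusProofs
import Summits.KontsevichZagierPeriods.KontsevichZagierPeriods.Theorems.InverseLandauTateLiftingPolydiscPow
import Summits.KontsevichZagierPeriods.KontsevichZagierPeriods.Theorems.InverseLandauTateLiftingTranscSector
import Summits.KontsevichZagierPeriods.KontsevichZagierPeriods.Theorems.InverseLandauTateLiftingBallEven
import Summits.KontsevichZagierPeriods.KontsevichZagierPeriods.Theorems.InverseLandauTateLiftingPointMul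
import Summits.KontsevichZagierPeriods.KontsevichZagierPeriods.Theorems.BetaCancellation.Negative.Torsion

/-!
# `TateLifting` (stmt-KontsevichZagierPeriods-9129), line `Sketch` — ROUTE EulerFormChain's `PolydiscConnect` ON THE π-SECTOR

Route EulerFormChain's crux `PolydiscConnect` (stmt-14238: every rational representation of value `q·πᵏ` is KZ-equivalent to the
polydisc `[D̄ᵏ, q]`) is Conjecture-1 strength as filed (at `k = 0` it is the kernel conjecture for rational values). On the
π-SECTOR — representations whose class in the formal period ring `P` lies in `K₀[⟦π⟧]` (radial balls of all dimensions, solids of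
revolution of conic bands, cones and cylinders over them, products of such, … : everything this line has put there) — it is a
THEOREM: `polydiscConnect_piSector`, from `polydiscPow` (the polydisc has class `⟦π⟧ᵏ`), Lindemann read in `P`
(`transcRingKernel`) and the scalar cancellation of `FormalRep ⧸ relations` (`equivalent_of_equivalent_constMul`).

Design: no definitions. References: M. Kontsevich, D. Zagier, *Periods* (2001), §1.2.
-/

noncomputable section

namespace Summit.KontsevichZagierPeriods.InverseLandau

open MeasureTheory Set
open Literature.NumberTheory.Transcendental
open Summit.KontsevichZagierPeriods.KontsevichZagierPeriods.BetaCancellationNegative (equivalent_of_equivalent_constMul)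

namespace PolydiscConnectPi

/-- Lindemann in `P`, sector form: an element of `K₀[⟦π⟧]` with value `0` is `0`. [cite: Lindemann1882] -/
theorem eq_zero_of_mem_piSubring {y : KZ.FormalPeriodRing}
    (hy : y ∈ Subring.closure
      (Set.range (fun b : KZ.IntegralRep 0 => KZ.toFormalPeriod (KZ.of b)) ∪ {KZ.toFormalPeriod (KZ.of KZ.piRep)}))
    (h0 : KZ.evalP y = 0) : y = 0 :=
  transcRingKernel _ Transc.algebraicIndependent_vecPi y (Subring.closure_mono BallEven.piSubring_generators_subset hy) h0

/-- The class of a scaled representation is the point class times the class: `⟦[σ, c·f]⟧ = ⟦[pt, c]⟧ · ⟦[σ, f]⟧`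
(`tateLifting_pointMul`). [cite: KontsevichZagier2001, §1.1] -/
theorem toFormalPeriod_constMul {n : ℕ} (r : KZ.IntegralRep n) (c : ℝ) (hc : IsAlgebraic ℚ c) :
    KZ.toFormalPeriod (KZ.of (r.constMul c hc)) =
      KZ.toFormalPeriod (KZ.of (KZ.IntegralRep.unit.constMul c hc)) * KZ.toFormalPeriod (KZ.of r) := by
  obtain ⟨r', hr'd, hr'i, hrel⟩ := tateLifting_pointMul n (KZ.IntegralRep.unit.constMul c hc) r (by simp)
  have h2 : KZ.of r' - KZ.of (r.constMul c hc) ∈ KZ.relations :=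
    KZ.of_sub_of_mem_relations_of_eqOn (by simp [hr'd]) fun x hx => by
      rw [hr'i (hr'd ▸ hx)]
      simp
  rw [← map_mul, KZ.toFormalPeriod_eq_iff]
  have : KZ.of (r.constMul c hc) - KZ.of (KZ.IntegralRep.unit.constMul c hc) * KZ.of r =
      -((KZ.of (KZ.IntegralRep.unit.constMul c hc) * KZ.of r - KZ.of r') + (KZ.of r' - KZ.of (r.constMul c hc))) := by
    abel
  rw [this]
  exact KZ.relations.neg_mem (KZ.relations.add_mem hrel h2)

end PolydiscConnectPi

open PolydiscConnectPi

/-- **ROUTE EulerFormChain's `PolydiscConnect` (stmt-KontsevichZagierPeriods-14238) ON THE π-SECTOR.** If the class of a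
representation `r` (any dimension) lies in `K₀[⟦π⟧] ⊆ P` and `r` has value `q·πᵏ` (`q ∈ ℚ`), then `r` is KZ-equivalent to the
polydisc representation `[D̄ᵏ, q]`. No hypothesis beyond the sector: Lindemann read in `P`, the polydisc class `⟦π⟧ᵏ`, and
scalar cancellation in the torsion-free, divisible group `FormalRep ⧸ relations`. [cite: KontsevichZagier2001, §1.2] -/
theorem polydiscConnect_piSector :
    ∀ (k : ℕ) (q : ℚ) {n : ℕ} (r : KZ.IntegralRep n) (p : KZ.IntegralRep (2 * k)),
    KZ.toFormalPeriod (KZ.of r) ∈ Subring.closure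
      (Set.range (fun b : KZ.IntegralRep 0 => KZ.toFormalPeriod (KZ.of b)) ∪ {KZ.toFormalPeriod (KZ.of KZ.piRep)}) →
    r.value = (q : ℝ) * Real.pi ^ k →
    p.domain = {v | ∀ i : Fin k, v ⟨2 * (i : ℕ), by omega⟩ ^ 2 + v ⟨2 * (i : ℕ) + 1, by omega⟩ ^ 2 ≤ 1} →
    (∀ v ∈ p.domain, p.integrand v = q) → KZ.Equivalent r p := by
  intro k q n r p hr hv hp hpi
  set R : Subring KZ.FormalPeriodRing := Subring.closure
    (Set.range (fun b : KZ.IntegralRep 0 => KZ.toFormalPeriod (KZ.of b)) ∪ {KZ.toFormalPeriod (KZ.of KZ.piRep)}) with hR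
  have hπ : KZ.toFormalPeriod (KZ.of KZ.piRep) ∈ R := Subring.subset_closure (Or.inr rfl)
  by_cases hq : q = 0
  · subst hq
    have hp0 : KZ.of p ∈ KZ.relations :=
      KZ.of_mem_relations_of_eqOn_zero p fun v hv => by simpa using hpi v hv
    have hr0 : KZ.of r ∈ KZ.relations := by
      rw [← KZ.toFormalPeriod_eq_zero_iff]
      refine eq_zero_of_mem_piSubring hr ?_
      rw [KZ.evalP_toFormalPeriod_of, hv]
      simp
    exact KZ.relations.sub_mem hr0 hp0
  · have hq0 : ((q : ℝ))⁻¹ ≠ 0 := inv_ne_zero (by exact_mod_cast hq)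
    have hqa : IsAlgebraic ℚ ((q : ℝ))⁻¹ := by
      have : IsAlgebraic ℚ ((q : ℝ)) := by
        rw [← map_ratCast (algebraMap ℚ ℝ) q]
        simpa using isAlgebraic_algebraMap (R := ℚ) (A := ℝ) (q : ℚ)
      exact this.inv
    refine equivalent_of_equivalent_constMul hqa hq0 ?_
    -- the scaled polydisc has integrand `1`, hence class `⟦π⟧ᵏ`
    have hP : KZ.toFormalPeriod (KZ.of (p.constMul _ hqa)) = KZ.toFormalPeriod (KZ.of KZ.piRep) ^ k :=
      tateLifting_polydiscPow k _ (by simpa using hp) fun v hv => by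
        rw [KZ.IntegralRep.integrand_constMul]
        show ((q : ℝ))⁻¹ * p.integrand v = 1
        rw [hpi v (by simpa using hv), inv_mul_cancel₀ (by exact_mod_cast hq)]
    -- the scaled `r` has class `⟦pt, q⁻¹⟧ · ⟦r⟧ ∈ K₀[⟦π⟧]`
    have hc : KZ.toFormalPeriod (KZ.of (KZ.IntegralRep.unit.constMul _ hqa)) ∈ R :=
      Subring.subset_closure (Or.inl ⟨_, rfl⟩)
    have hmem : KZ.toFormalPeriod (KZ.of (r.constMul _ hqa)) - KZ.toFormalPeriod (KZ.of (p.constMul _ hqa)) ∈ R := by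
      rw [toFormalPeriod_constMul, hP]
      exact R.sub_mem (R.mul_mem hc hr) (R.pow_mem hπ k)
    have h0 : KZ.evalP (KZ.toFormalPeriod (KZ.of (r.constMul _ hqa)) - KZ.toFormalPeriod (KZ.of (p.constMul _ hqa))) = 0 := by
      rw [map_sub, hP, map_pow, KZ.evalP_toFormalPeriod_of, KZ.evalP_toFormalPeriod_of, KZ.IntegralRep.value_constMul, hv,
        KZ.piRep_value, ← mul_assoc, inv_mul_cancel₀ (by exact_mod_cast hq), one_mul, sub_self]
    have := eq_zero_of_mem_piSubring hmem h0
    show KZ.of _ - KZ.of _ ∈ KZ.relations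
    rw [← KZ.toFormalPeriod_eq_iff]
    exact sub_eq_zero.1 this

end Summit.KontsevichZagierPeriods.InverseLandau

end
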